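import Literature.MathematicalPhysics.QuantumFieldTheory.Balaban1983to89.B9PinGeometryKLevelV1

/-!
# `Balaban1983to89.B9PinGeometryKLevelV1B` — MODULE 4B: the BRIDGED THRESHOLD CONSTANT `c35B ℓ := 10·L⁴` of the N06 certificate's
# smallness clauses after CASCADE-R STEP 3 (class of record := print's class)

B9 = T. Bałaban, *Propagators for lattice gauge theories in a background field*, Commun. Math. Phys. **99** (1985) 389–434 [Balaban1985BackgroundPropagators]
pub-ymgap Track A, node N06; seat `node00-def-Y` g22 (OWNER of MODULES 2 · 2P · 3R · 4), on dag-n06-d g12's «WANTED c35B» (fleet bus 2026-08-28 12:16Z) for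
EDITION 39 = CASCADE-R STEP 3, form (α) (def-Y RULING STEP-3 FORM, bus 12:10Z).  CONSTANTS + ORDER BOOKKEEPING ONLY; nothing of [B9] asserted; count-neutral.

WHY THIS CONSTANT.  Print (p. 396): «Here O(1) will mean a number ≧ 10 … |A| < O(1)Mα₀(Lʲη)⁻¹, |∇^ηA| < O(1)Mα₀(Lʲη)⁻² on □, where O(1)M is a size of □» — print's
cube class is MODULE 2P `B9BackgroundsKLevelV1P.cubeClassP ∕ bg9YP` (threshold `c35Y = 10` = MODULE 4 `B9PinGeometryKLevelV1.c35Y`).  After STEP 3 the record's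
premises read `(bg9YP 𝔸 G x).Reg335 c35Y α₀ U` ∕ `.Reg336 c35Y α₀ U`, and every supplier typed at MODULE 2's small-cube class `(bg9Y 𝔸 G x).Reg335 c α₀ U` is fed
through dag-n06-j's kernel-checked bridge `B9Eq335ClassBridgePV1.regY335_of_regYP335` (print's class at `c ≤ 10` ⇒ small-cube class at any `c′ ≥ 10·L³`,
`L = ℓ + 1`) ∕ `regY336_of_regYP336` (`c′ ≥ 10·L⁴`).  ONE threshold dominating both, **`c35B ℓ := 10·((ℓ+1 : ℕ) : ℝ)^4`**, lets the edition state every smallness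
side condition once, as `c35B ℓ · M · α₀ ≤ a` (print's order of constants: `L`, then `M`, then `α₀` — Thm 3.1 p. 397: constants «dependent on d and L only … for
M ≧ M₁» and «Mα₀ ≦ δ₀»; p. 396 l.25–26 «We will need α₀ so small that O(1)Mα₀ is still a sufficiently small number»; Thm 3.2 inherits Thm 3.1's assumptions —
ref-E NIT-1 on v1.0, doc-only v1.1), and recover the three instances `c35Y·M·α₀ ≤ a`, `10L³·M·α₀ ≤ a`, `10L⁴·M·α₀ ≤ a` by the §2 lemmas.

WHAT IS DEFINED ∕ PROVED.
* §1 `c35B ℓ`, `c35B_eq`, `c35B_pos`, `c35B_nonneg`, `c35Y_le_ten`, `ten_le_c35B`, `c35Y_le_c35B`, `ten_L3_le_c35B`, `ten_L4_le_c35B` (the two `hc′` of the bridge: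
  `regY335_of_regYP335 x c35Y_le_ten hα h (ten_L3_le_c35B ℓ) : (bg9Y 𝔸 G x).Reg335 (c35B ℓ) α₀ U`, and `regY336_of_regYP336 x c35Y_le_ten hα h (ten_L4_le_c35B ℓ)`).
* §2 smallness bookkeeping: `mul_mul_le_of_le_of_c35B` (`c ≤ c35B ℓ → 0 ≤ M·α₀ → c35B ℓ·M·α₀ ≤ a → c·M·α₀ ≤ a`) and its three instances
  `c35Y_smallness_of_c35B`, `ten_L3_smallness_of_c35B`, `ten_L4_smallness_of_c35B`; `c35B_smallness_pos` (`0 < M → 0 < α₀ → 0 < c35B ℓ·M·α₀`).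

HONEST FRAMING: Literature-side constants for a typed re-press; no estimate of [B9] is asserted or weakened; N06 NOT discharged; nothing continuum ∕ OS ∕ mass gap ∕ Clay.
-/

namespace Literature.MathematicalPhysics.QuantumFieldTheory.Balaban1983to89.B9PinGeometryKLevelV1B

open Literature.MathematicalPhysics.QuantumFieldTheory.Balaban1983to89.B9PinGeometryKLevelV1 (c35Y c35Y_eq c35Y_pos)

/-! ## §1 the constant and its order facts -/

/-- **the bridged threshold** `10·L⁴` (`L = ℓ + 1`): dominates print's threshold `c35Y = 10` and both outputs `10·L³` ((3.35)) and `10·L⁴` ((3.36)) of the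
class bridge `B9Eq335ClassBridgePV1`. [cite: Balaban1985BackgroundPropagators, (3.35)–(3.36) p.396 («Here O(1) will mean a number ≧ 10»; bookkeeping)] -/
def c35B (ℓ : ℕ) : ℝ := 10 * ((ℓ + 1 : ℕ) : ℝ) ^ 4

/-- `c35B ℓ = 10·(ℓ+1)⁴`. [cite: Balaban1985BackgroundPropagators, p.396 (bookkeeping)] -/
theorem c35B_eq (ℓ : ℕ) : c35B ℓ = 10 * ((ℓ + 1 : ℕ) : ℝ) ^ 4 := rfl

/-- `1 ≤ L` as a real number. [cite: Balaban1985BackgroundPropagators, p.396 (bookkeeping)] -/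
theorem one_le_L (ℓ : ℕ) : (1 : ℝ) ≤ ((ℓ + 1 : ℕ) : ℝ) := by
  exact_mod_cast Nat.succ_le_succ (Nat.zero_le ℓ)

/-- `0 < c35B ℓ`. [cite: Balaban1985BackgroundPropagators, p.396 (bookkeeping)] -/
theorem c35B_pos (ℓ : ℕ) : 0 < c35B ℓ := by
  have hL := one_le_L ℓ
  unfold c35B
  positivity

/-- `0 ≤ c35B ℓ`. [cite: Balaban1985BackgroundPropagators, p.396 (bookkeeping)] -/
theorem c35B_nonneg (ℓ : ℕ) : 0 ≤ c35B ℓ := (c35B_pos ℓ).le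

/-- `c35Y ≤ 10` (the bridge's `hc`). [cite: Balaban1985BackgroundPropagators, p.396 («≧ 10»; bookkeeping)] -/
theorem c35Y_le_ten : c35Y ≤ 10 := le_of_eq c35Y_eq

/-- `10 ≤ c35B ℓ`. [cite: Balaban1985BackgroundPropagators, p.396 (bookkeeping)] -/
theorem ten_le_c35B (ℓ : ℕ) : (10 : ℝ) ≤ c35B ℓ := by
  have hL := one_le_L ℓ
  have h4 : (1 : ℝ) ≤ ((ℓ + 1 : ℕ) : ℝ) ^ 4 := one_le_pow₀ hL
  unfold c35B
  nlinarith

/-- `c35Y ≤ c35B ℓ`. [cite: Balaban1985BackgroundPropagators, p.396 (bookkeeping)] -/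
theorem c35Y_le_c35B (ℓ : ℕ) : c35Y ≤ c35B ℓ := c35Y_le_ten.trans (ten_le_c35B ℓ)

/-- `10·L³ ≤ c35B ℓ` (the bridge's `hc′` for (3.35)). [cite: Balaban1985BackgroundPropagators, (3.35) p.396 (bookkeeping)] -/
theorem ten_L3_le_c35B (ℓ : ℕ) : 10 * ((ℓ + 1 : ℕ) : ℝ) ^ 3 ≤ c35B ℓ := by
  have hL := one_le_L ℓ
  have h3 : (0 : ℝ) ≤ ((ℓ + 1 : ℕ) : ℝ) ^ 3 := by positivity
  unfold c35B
  nlinarith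

/-- `10·L⁴ ≤ c35B ℓ` (the bridge's `hc′` for (3.36); an equality). [cite: Balaban1985BackgroundPropagators, (3.36) p.396 (bookkeeping)] -/
theorem ten_L4_le_c35B (ℓ : ℕ) : 10 * ((ℓ + 1 : ℕ) : ℝ) ^ 4 ≤ c35B ℓ := le_rfl

/-- `10·L³ ≤ 10·L⁴`. [cite: Balaban1985BackgroundPropagators, p.396 (bookkeeping)] -/
theorem ten_L3_le_ten_L4 (ℓ : ℕ) : 10 * ((ℓ + 1 : ℕ) : ℝ) ^ 3 ≤ 10 * ((ℓ + 1 : ℕ) : ℝ) ^ 4 := ten_L3_le_c35B ℓ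

/-! ## §2 smallness bookkeeping: one clause `c35B ℓ · M · α₀ ≤ a` serves every threshold below it -/

/-- a smallness clause at `c35B` serves any threshold `c ≤ c35B ℓ`. [cite: Balaban1985BackgroundPropagators, p.396 l.25–26 («α₀ so small that O(1)Mα₀ is still a sufficiently small number»), Thm 3.1 p.397 («Mα₀ ≦ δ₀»; bookkeeping)] -/
theorem mul_mul_le_of_le_of_c35B {ℓ : ℕ} {c M α₀ a : ℝ} (hc : c ≤ c35B ℓ) (hMα : 0 ≤ M * α₀) (h : c35B ℓ * M * α₀ ≤ a) :
    c * M * α₀ ≤ a := by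
  have : c * M * α₀ ≤ c35B ℓ * M * α₀ := by
    rw [mul_assoc, mul_assoc]
    exact mul_le_mul_of_nonneg_right hc hMα
  exact this.trans h

/-- the record's letter: `c35B·M·α₀ ≤ a ⇒ c35Y·M·α₀ ≤ a`. [cite: Balaban1985BackgroundPropagators, p.396 (bookkeeping)] -/
theorem c35Y_smallness_of_c35B {ℓ : ℕ} {M α₀ a : ℝ} (hMα : 0 ≤ M * α₀) (h : c35B ℓ * M * α₀ ≤ a) : c35Y * M * α₀ ≤ a :=
  mul_mul_le_of_le_of_c35B (c35Y_le_c35B ℓ) hMα h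

/-- the (3.35) bridge output: `c35B·M·α₀ ≤ a ⇒ 10L³·M·α₀ ≤ a`. [cite: Balaban1985BackgroundPropagators, (3.35) p.396 (bookkeeping)] -/
theorem ten_L3_smallness_of_c35B {ℓ : ℕ} {M α₀ a : ℝ} (hMα : 0 ≤ M * α₀) (h : c35B ℓ * M * α₀ ≤ a) :
    10 * ((ℓ + 1 : ℕ) : ℝ) ^ 3 * M * α₀ ≤ a :=
  mul_mul_le_of_le_of_c35B (ten_L3_le_c35B ℓ) hMα h

/-- the (3.36) bridge output: `c35B·M·α₀ ≤ a ⇒ 10L⁴·M·α₀ ≤ a` (an unfolding). [cite: Balaban1985BackgroundPropagators, (3.36) p.396 (bookkeeping)] -/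
theorem ten_L4_smallness_of_c35B {ℓ : ℕ} {M α₀ a : ℝ} (h : c35B ℓ * M * α₀ ≤ a) :
    10 * ((ℓ + 1 : ℕ) : ℝ) ^ 4 * M * α₀ ≤ a := h

/-- a threshold-10 clause: `c35B·M·α₀ ≤ a ⇒ 10·M·α₀ ≤ a`. [cite: Balaban1985BackgroundPropagators, p.396 (bookkeeping)] -/
theorem ten_smallness_of_c35B {ℓ : ℕ} {M α₀ a : ℝ} (hMα : 0 ≤ M * α₀) (h : c35B ℓ * M * α₀ ≤ a) : 10 * M * α₀ ≤ a :=
  mul_mul_le_of_le_of_c35B (ten_le_c35B ℓ) hMα h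

/-- positivity of the clause's left side. [cite: Balaban1985BackgroundPropagators, p.396 (bookkeeping)] -/
theorem c35B_smallness_pos (ℓ : ℕ) {M α₀ : ℝ} (hM : 0 < M) (hα : 0 < α₀) : 0 < c35B ℓ * M * α₀ :=
  mul_pos (mul_pos (c35B_pos ℓ) hM) hα

/-- from the clause and `0 < M`, `0 < α₀`: `0 < a`. [cite: Balaban1985BackgroundPropagators, p.396 (bookkeeping)] -/
theorem pos_of_c35B_smallness {ℓ : ℕ} {M α₀ a : ℝ} (hM : 0 < M) (hα : 0 < α₀) (h : c35B ℓ * M * α₀ ≤ a) : 0 < a :=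
  (c35B_smallness_pos ℓ hM hα).trans_le h

end Literature.MathematicalPhysics.QuantumFieldTheory.Balaban1983to89.B9PinGeometryKLevelV1B
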